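import Literature.AnabelianGeometry.EtaleTheta.Discharge.Sec2CyclotomeModOneOfTrivialActions
import HarnessLib

/-!
# [EtTh] Def. 2.13's cyclotome datum `μ_N ≅ (l·Δ_Θ) ⊗ ℤ/N` for EVERY `l ≥ 1` at settings of [EtTh] origin with `Π^tp_X` CENTRALISING
# `Δ_Θ` and fixing `μ_N` — and the κ′ census of the cyclotome binder for every `l ≥ 1` (proof-only; sequel of p475618, which did `l = 1`)

S. Mochizuki, *The étale theta function and its Frobenioid-theoretic manifestations*, Publ. RIMS **45** (2009) [EtTh], §2 Def. 2.13 p. 46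
(«the natural isomorphism `μ_N ≅ (l·Δ_Θ) ⊗ (ℤ/Nℤ)`»), Prop. 2.12 (i) p. 45 («`l · Δ_Θ`») [cite: MochizukiEtTh2009, Def 2.13 p.46].
Cell abc-iut, layer L2, seat abc-iut-L2-t10 (gen 7), last in-lineage item after (N2). PROOF-ONLY (0 definitions).

Same construction as p475618 (`Sec2CyclotomeModOneOfTrivialActions`, `l = 1`) on the subgroup `l·Δ_Θ` of `l`-th powers: abc-iut-L2-d1's
abstract `l·Δ_Θ ≃* Ẑ` (`IsEtThOrigin.nonempty_lDeltaTheta_mulEquiv_zHat`, `l ≠ 0`), the level map `Ẑ → ℤ/N` and `k ↦ ε^k` for a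
primitive `ε ∈ μ_N(ℚ̄_p)`; continuity WITHOUT coordinates: `l·Δ_Θ` = the image of the `l`-th power map on the COMPACT `Δ_Θ` is compact,
so `Ker red` (= the `N`-th powers of `l·Δ_Θ`) is closed of finite index `N`, hence open; equivariance: both actions trivial.

* `ThetaSetting.nonempty_cyclotomeMod_of_conj_eq` — generic, every `l ≠ 0`, every `N`;
* **`SettingModel.nonempty_cyclotomeMod_modelκ'_of`** / **`nonempty_cyclotomeMod_modelκ'_iff`** — at `modelκ′`, for every `l ≠ 0`:
  `Nonempty (CyclotomeMod l N) ↔ N ∣ p − 1 ∨ (p = 2 ∧ N = 2)` (negative half = K11 `isEmpty_cyclotomeMod_modelκ'_of_not`, stated there for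
  every `l`) — K11's census closed in both halves for EVERY `l ≥ 1`.

HONEST LIMITS: semi-synthetic model = consistency evidence for the typed interface only; `l = 0` (`0·Δ_Θ = 1`) not treated; nothing of
[EtTh] asserted; no side taken on [IUTchIII] Cor. 3.12; typed ≠ proved.
-/

noncomputable section

open CategoryTheory ProfiniteGrp ProfiniteGrp.ProfiniteCompletion
open _root_.Topology _root_.Filter

namespace Literature.AnabelianGeometry.EtaleTheta

namespace ThetaSetting

open Literature.AnabelianGeometry.SemiGraphs

variable {p : ℕ} [Fact p.Prime] {D : ThetaSetting p}

/-- `l·Δ_Θ` is the image of the `l`-th power map on `Δ_Θ` (its definition, as sets). [cite: MochizukiEtTh2009, Prop 2.12 (i) p.45] -/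
theorem coe_lDeltaTheta_eq_image (D : ThetaSetting p) (l : ℕ) :
    ((D.lDeltaTheta l : Subgroup D.GtpTheta) : Set D.GtpTheta) =
      (fun a : D.GtpTheta => a ^ l) '' ((D.DeltaTheta : Subgroup D.GtpTheta) : Set D.GtpTheta) := by
  ext x
  constructor
  · rintro ⟨y, hy, rfl⟩
    exact ⟨y, hy, rfl⟩
  · rintro ⟨y, hy, rfl⟩
    exact ⟨y, hy, rfl⟩

/-- **A level-`(l, N)` cyclotome datum EXISTS, for every `l ≠ 0`, at every setting of [EtTh] origin (bundle `op`, binder `hYcl`,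
Hausdorff `(Π^tp_X)^Θ`) whose `Π^tp_X` centralises `Δ_Θ` and fixes `μ_N(ℚ̄_p)` through `aug`** (p475618's construction on `l·Δ_Θ`).
[cite: MochizukiEtTh2009, Def 2.13 p.46] -/
theorem nonempty_cyclotomeMod_of_conj_eq [T2Space D.GtpTheta] (op : D.OncePuncturedData)
    (hYcl : (D.DtpY.map D.toHat.toMonoidHom).topologicalClosure ≤
      D.DtpY.map D.toHat.toMonoidHom ⊔ (⁅⁅D.DeltaHat, D.DeltaHat⁆, D.DeltaHat⁆).topologicalClosure)
    {l : ℕ} (hl : l ≠ 0) (N : ℕ+)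
    (hconj : ∀ (σ : D.PiTemp) (a : D.GtpTheta), a ∈ D.DeltaTheta → D.toTheta σ * a * (D.toTheta σ)⁻¹ = a)
    (hgal : ∀ (σ : D.PiTemp) (m : MuN p N), galMuN p N (D.aug.toMonoidHom σ) m = m) :
    Nonempty (D.CyclotomeMod l N) := by
  classical
  haveI : NeZero (N : ℕ) := ⟨N.ne_zero⟩
  -- abc-iut-L2-d1's abstract coordinate on `l·Δ_Θ` and the compactness of `l·Δ_Θ`
  obtain ⟨e⟩ := op.origin.nonempty_lDeltaTheta_mulEquiv_zHat hYcl hl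
  have hcpt : IsCompact ((D.lDeltaTheta l : Subgroup D.GtpTheta) : Set D.GtpTheta) := by
    rw [D.coe_lDeltaTheta_eq_image l]
    exact (D.isCompact_deltaTheta_of_groupLevelData op.toGroupLevelData hYcl).image (continuous_pow l)
  haveI : CompactSpace ↥(D.lDeltaTheta l) := isCompact_iff_compactSpace.mp hcpt
  -- a primitive `N`-th root of unity `ε ∈ μ_N(ℚ̄_p)`
  haveI : NeZero ((N : ℕ) : PadicAlgCl p) := ⟨by exact_mod_cast N.ne_zero⟩
  obtain ⟨ζ0, hζ0⟩ := HasEnoughRootsOfUnity.prim (M := PadicAlgCl p) (n := (N : ℕ))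
  set ε : MuN p N := hζ0.toRootsOfUnity with hε
  have hεprim : IsPrimitiveRoot ε (N : ℕ) := by
    have hinj : Function.Injective
        ((Units.coeHom (PadicAlgCl p)).comp (rootsOfUnity N (PadicAlgCl p)).subtype) := by
      intro a b h
      exact Subtype.ext (Units.ext h)
    refine IsPrimitiveRoot.of_map_of_injective
      (f := (Units.coeHom (PadicAlgCl p)).comp (rootsOfUnity N (PadicAlgCl p)).subtype) ?_ hinj
    show IsPrimitiveRoot (((ε : (PadicAlgCl p)ˣ)) : PadicAlgCl p) N
    rw [hε, IsPrimitiveRoot.val_toRootsOfUnity_coe]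
    exact hζ0
  -- `k ↦ ε^k : ℤ/N → μ_N`
  let φ : Multiplicative (ZMod N) →* MuN p N :=
    { toFun := fun k => ε ^ (Multiplicative.toAdd k).val
      map_one' := by rw [toAdd_one, ZMod.val_zero, pow_zero]
      map_mul' := fun a b => by
        change ε ^ (Multiplicative.toAdd a + Multiplicative.toAdd b).val =
          ε ^ (Multiplicative.toAdd a).val * ε ^ (Multiplicative.toAdd b).val
        rw [← pow_add, ZMod.val_add, ← pow_eq_pow_mod _ hεprim.pow_eq_one] }
  have hφ : ∀ k, φ k = ε ^ (Multiplicative.toAdd k).val := fun _ => rfl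
  have hφ_ker : ∀ k : Multiplicative (ZMod N), φ k = 1 ↔ k = 1 := by
    intro k
    rw [hφ, hεprim.pow_eq_one_iff_dvd]
    constructor
    · intro h
      have hv : (Multiplicative.toAdd k).val = 0 := Nat.eq_zero_of_dvd_of_lt h (ZMod.val_lt _)
      rw [ZMod.val_eq_zero] at hv
      exact toAdd_eq_zero.mp hv
    · rintro rfl
      rw [toAdd_one, ZMod.val_zero]
      exact dvd_zero _
  -- `red : l·Δ_Θ → μ_N`
  let red : ↥(D.lDeltaTheta l) →* MuN p N := φ.comp ((ZHatLevel.level N).comp e.toMonoidHom)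
  have hred : ∀ x, red x = φ (ZHatLevel.level N (e x)) := fun _ => rfl
  -- onto
  have hred_surj : Function.Surjective red := by
    intro u
    have huN : (((u : (PadicAlgCl p)ˣ)) : PadicAlgCl p) ^ (N : ℕ) = 1 := by
      have h := (mem_rootsOfUnity _ _).mp u.2
      rw [← Units.val_pow_eq_pow_val, h, Units.val_one]
    obtain ⟨i, hi, hiu⟩ := hζ0.eq_pow_of_pow_eq_one huN
    refine ⟨e.symm (ZHatLevel.eta (i : ℤ)), ?_⟩
    rw [hred, MulEquiv.apply_symm_apply, ZHatLevel.level_eta, hφ, toAdd_ofAdd, Int.cast_natCast, ZMod.val_natCast,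
      Nat.mod_eq_of_lt hi]
    apply Subtype.ext
    apply Units.ext
    rw [← hiu, Subgroup.coe_pow, Units.val_pow_eq_pow_val, hε, IsPrimitiveRoot.val_toRootsOfUnity_coe]
  -- kernel = the `N`-th powers
  have hred_ker : ∀ x, red x = 1 ↔ ∃ y : ↥(D.lDeltaTheta l), x = y ^ (N : ℕ) := by
    intro x
    rw [hred, hφ_ker, ZHatLevel.level_eq_one_iff_exists_pow]
    constructor
    · rintro ⟨z, hz⟩
      refine ⟨e.symm z, e.injective ?_⟩
      rw [map_pow, MulEquiv.apply_symm_apply, hz]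
    · rintro ⟨y, rfl⟩
      exact ⟨e y, by rw [map_pow]⟩
  -- continuity: the kernel is closed (image of the `N`-th power map on a compact group) of finite index `N`, hence open
  have hker_closed : IsClosed ((red.ker : Subgroup ↥(D.lDeltaTheta l)) : Set ↥(D.lDeltaTheta l)) := by
    have hrange : ((red.ker : Subgroup ↥(D.lDeltaTheta l)) : Set ↥(D.lDeltaTheta l)) =
        Set.range fun y : ↥(D.lDeltaTheta l) => y ^ (N : ℕ) := by
      ext x
      rw [SetLike.mem_coe, MonoidHom.mem_ker, hred_ker, Set.mem_range]
      constructor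
      · rintro ⟨y, rfl⟩
        exact ⟨y, rfl⟩
      · rintro ⟨y, rfl⟩
        exact ⟨y, rfl⟩
    rw [hrange]
    exact (isCompact_range (continuous_pow (N : ℕ))).isClosed
  haveI : (red.ker : Subgroup ↥(D.lDeltaTheta l)).FiniteIndex := by
    refine ⟨?_⟩
    rw [Subgroup.index_ker, MonoidHom.range_eq_top.mpr hred_surj, Subgroup.card_top, Nat.card_eq_fintype_card, card_MuN]
    exact N.ne_zero
  have hker_open : IsOpen ((red.ker : Subgroup ↥(D.lDeltaTheta l)) : Set ↥(D.lDeltaTheta l)) :=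
    red.ker.isOpen_of_isClosed_of_finiteIndex hker_closed
  have hcont : Continuous red := by
    refine (IsLocallyConstant.iff_isOpen_fiber.mpr fun u => ?_).continuous
    rw [isOpen_iff_forall_mem_open]
    intro y hy
    refine ⟨(fun k => y * k) '' (red.ker : Set ↥(D.lDeltaTheta l)), ?_, (Homeomorph.mulLeft y).isOpenMap _ hker_open,
      ⟨1, one_mem _, mul_one y⟩⟩
    rintro _ ⟨k, hk, rfl⟩
    rw [Set.mem_preimage, Set.mem_singleton_iff, map_mul, (MonoidHom.mem_ker).mp hk, mul_one]
    exact hy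
  -- assemble (equivariance: both actions are trivial)
  refine ⟨{ red := red
            red_surjective := hred_surj
            red_ker := hred_ker
            continuous_red := hcont
            red_conj := fun σ x => ?_ }⟩
  rw [hgal]
  exact congrArg red (Subtype.ext (hconj σ x (D.lDeltaTheta_le l x.2)))

end ThetaSetting

/-! ### The untwisted Krull model `κ′`: the census for EVERY `l ≥ 1` -/

namespace SettingModel

open Literature.AnabelianGeometry.SemiGraphs ThetaSetting

variable (p : ℕ) [Fact p.Prime]

/-- **`CyclotomeMod l N` is INHABITED at `modelκ′` for every `l ≠ 0` and `N ∣ p − 1 ∨ (p = 2 ∧ N = 2)`** (K7 centrality,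
`galMuN_eq_one_iff`, `hYcl_modelκ'`, the κ′ cusp bundle, `CurveTheta.t2Space_GTheta`). [cite: MochizukiEtTh2009, Def 2.13 p.46] -/
theorem nonempty_cyclotomeMod_modelκ'_of {l : ℕ} (hl : l ≠ 0) (N : ℕ+) (hN : (N : ℕ) ∣ p - 1 ∨ (p = 2 ∧ (N : ℕ) = 2)) :
    Nonempty ((ThetaSetting.modelκ' p).CyclotomeMod l N) := by
  haveI : T2Space (ThetaSetting.modelκ' p).GtpTheta := CurveTheta.t2Space_GTheta (curveκ' p)
  exact nonempty_cyclotomeMod_of_conj_eq (nonempty_oncePuncturedData_modelκ' p).some (hYcl_modelκ' p) hl N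
    (fun σ a ha => toTheta_conj_eq_of_mem_deltaTheta_modelκ' p _ a ha)
    (forall_galMuN_aug_eq_of_galMuN_eq_one ((galMuN_eq_one_iff p N).mpr hN))

/-- **EXACT κ′ CENSUS of the cyclotome datum for every `l ≠ 0`**: `CyclotomeMod l N` at `modelκ′` is inhabited IFF
`N ∣ p − 1 ∨ (p = 2 ∧ N = 2)` (negative half = K11 `isEmpty_cyclotomeMod_modelκ'_of_not`, every `l`). [cite: MochizukiEtTh2009, Def 2.13 p.46] -/
theorem nonempty_cyclotomeMod_modelκ'_iff {l : ℕ} (hl : l ≠ 0) (N : ℕ+) :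
    Nonempty ((ThetaSetting.modelκ' p).CyclotomeMod l N) ↔ (N : ℕ) ∣ p - 1 ∨ (p = 2 ∧ (N : ℕ) = 2) := by
  refine ⟨fun h => ?_, nonempty_cyclotomeMod_modelκ'_of p hl N⟩
  by_contra hN
  exact (isEmpty_cyclotomeMod_modelκ'_of_not p l N hN).false h.some

/-- The same datum read on the `MuTwoSetting` of the κ′ R-row (`(inversionModelκ′ p).toThetaSetting = modelκ′ p`, `rfl`).
[cite: MochizukiEtTh2009, Def 2.13 p.46] -/
theorem nonempty_cyclotomeMod_inversionModelκ'_of {l : ℕ} (hl : l ≠ 0) (N : ℕ+)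
    (hN : (N : ℕ) ∣ p - 1 ∨ (p = 2 ∧ (N : ℕ) = 2)) :
    Nonempty ((MuTwoSetting.inversionModelκ' p).toThetaSetting.CyclotomeMod l N) :=
  nonempty_cyclotomeMod_modelκ'_of p hl N hN

end SettingModel

end Literature.AnabelianGeometry.EtaleTheta

end
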